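import Literature.AlgebraicGeometry.Pohlmann1968.HodgeClassesProductSpanCMProductsSplit
import Literature.AlgebraicGeometry.Pohlmann1968.HodgeClassesProductSpanCMProductsDisjoint
import Literature.AlgebraicGeometry.Pohlmann1968.NondegenerateCMAlgebraTypes
import Literature.NumberTheory.ComplexMultiplication.CMTypeRankTwoBlocks
import HarnessLib

/-!
# Hodge classes on `X × Y` for CM products: the product-span property from RANK ADDITIVITY
# `rank(Φ ⊔ Φ') + 1 = rank Φ + rank Φ'` (Moonen–Zarhin's criterion `Hg(X × Y) = Hg(X) × Hg(Y)` for CM abelian varieties)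

Family `hodge`, layer `Literature/AlgebraicGeometry/Pohlmann1968`; cell `pub-hodgecm2` (COR-CM), count-neutral own-lane
sequel of `Pohlmann1968/HodgeClassesProductSpanCMProducts` (blockwise independent Galois action ⟹ product span) and
`…CMProductsSplit` (the engine with the block-splitting hypothesis).  HONEST FRAMING: unconditional structure theorem on
Hodge classes of CM abelian varieties; not a step of the summit chain.

THE THEOREM (`hodgeClassesProductSpan_biproduct_of_typeRank_add`).  `K_i` (`i < n`), `K'_j` (`j < m`) CM fields with CM
types `Φ_i`, `Φ'_j` realised by `(A_i, ι_i, θ_i)`, `(A'_j, ι'_j, θ'_j)`; `X = ⨁ A_i`, `Y = ⨁ A'_j`; `Σ = ⊔_i Φ_i ⊆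
⊔_i Hom(K_i, ℂ)` and `Σ' = ⊔_j Φ'_j` Deligne's types of the CM algebras `∏ K_i`, `∏ K'_j` (`CMAlgebra.familyType`), of ranks
`cmFamilyRank Φ = dim MT(X)`, `cmFamilyRank Φ' = dim MT(Y)` (Deligne I Ex. 3.7 (c); the tree's
`mtRank_hodge_one_eq_cmFamilyRank_of_isIsogenous_biproduct`), and `Σ ⊔ Σ'` the type of `∏ K_i × ∏ K'_j` (of `X × Y`).  IF

  `rank(Σ ⊔ Σ') + 1 = rank Σ + rank Σ'`   (⟺ `dim Hg(X × Y) = dim Hg(X) + dim Hg(Y)` ⟺ `Hg(X × Y) = Hg(X) × Hg(Y)`)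

THEN `HodgeTheory.HodgeClassesProductSpan X Y`: every rational Hodge class on `X × Y` is a `ℂ`-combination of exterior
products `pr_X^* a ∪ pr_Y^* b` of rational Hodge classes of the factors — Moonen–Zarhin 1999 (3.1) (⟸) for CM abelian
varieties.  This is STRICTLY MORE than blockwise independence (`typeRank_sum_add_one_eq_of_blockwiseIndependent` below
recovers that hypothesis as a special case): e.g. two simple CM abelian surfaces with multiplication by the two cyclic
quartic CM fields containing `ℚ(√5)` have Galois closures meeting in `ℚ(√5) ≠ ℚ`, yet their types are rank-additive (a
function on `Gal` factoring through `Gal(ℚ(√5)/ℚ)` and lying in the span of the translates of a primitive quartic type is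
constant).  The inequality `rank(Σ ⊔ Σ') + 1 ≤ rank Σ + rank Σ'` always holds (`typeRank_sum_add_one_le_cmFamilyRank`).

PROOF.  `…CMProductsSplit` reduces the claim to: every weight `S` on `(⊔ Hom(K_i,ℂ)) ⊔ (⊔ Hom(K'_j,ℂ))` balanced for the
glued pair splits into balanced blocks.  Balancedness of `S` is Pohlmann's condition for its indicator weight
(`isBalanced_indicator_iff_forall_ncard_eq`), and under rank additivity the indicator's blocks are balanced
(`NumberTheory/ComplexMultiplication/CMTypeRankTwoBlocks`: `U(Σ ⊔ Σ') = U(Σ) × U(Σ')`, so `(u_τ, 0) ⊥ 𝟙_S`); the value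
bookkeeping `p₁ + p₂ = p` is `|S| = |S.toLeft| + |S.toRight|`.  Consequences: isogenous factors, `HC(X) ∧ HC(Y) ⟹ HC(X × Y)`.
Theorems only; no definition, no named fact; axioms `propext`, `Classical.choice`, `Quot.sound`.

## References
* [MoonenZarhin1999LowDim] B. Moonen, Yu. Zarhin, Math. Ann. 315 (1999) 711–733, §3 (3.1), Cor. (3.9).
* [Gordon1999HodgeAVSurvey] B. B. Gordon, *A survey of the Hodge conjecture for abelian varieties*, §3, 7.5–7.7, 9.1–9.2.
* [Deligne1982HodgeCycles] P. Deligne, *Hodge cycles on abelian varieties*, LNM 900 (1982), I Ex. 3.7 (c).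
* [GaoUllmo2025] Z. Gao, E. Ullmo, J. Inst. Math. Jussieu 25 (2025), Thm. 3.1 (Pohlmann for a CM algebra).
-/

noncomputable section

open CategoryTheory CategoryTheory.Limits NumberField

namespace Literature.AlgebraicGeometry.Pohlmann1968

open Module
open Literature.AlgebraicGeometry.Motives (AbelianVariety CMType)
open Literature.AlgebraicGeometry.HodgeTheory
open Literature.AlgebraicGeometry.ComplexMultiplication (IsCMTypeRealisation)
open Literature.NumberTheory.ComplexMultiplication

/-! ### §1 Pohlmann's counting condition for a finite weight = balancedness of its indicator -/

section Indicator

variable {G : Type*} [Group G] {E : Type*} [MulAction G E] [Fintype E] [DecidableEq E]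

/-- `Σ_x 𝟙_T(x)[g x ∈ Ψ] = #{x ∈ T | g x ∈ Ψ}`. [folklore] -/
private theorem sum_indicator_mul_translateInd (Ψ : Set E) (T : Finset E) (g : G) :
    ∑ x, (if x ∈ T then (1 : ℚ) else 0) * translateInd Ψ g x = ({x | x ∈ T ∧ g • x ∈ Ψ}.ncard : ℚ) := by
  classical
  have hset : {x | x ∈ T ∧ g • x ∈ Ψ} = ↑(Finset.univ.filter fun x => x ∈ T ∧ g • x ∈ Ψ) := by
    ext x
    simp only [Set.mem_setOf_eq, Finset.coe_filter, Finset.mem_univ, true_and]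
  have hterm : ∀ x, (if x ∈ T then (1 : ℚ) else 0) * translateInd Ψ g x =
      if x ∈ T ∧ g • x ∈ Ψ then (1 : ℚ) else 0 := by
    intro x
    by_cases hx : x ∈ T
    · by_cases hgx : g • x ∈ Ψ
      · rw [if_pos hx, translateInd_of_mem hgx, if_pos ⟨hx, hgx⟩, one_mul]
      · rw [if_pos hx, translateInd_of_not_mem hgx, if_neg fun h => hgx h.2, mul_zero]
    · rw [if_neg hx, zero_mul, if_neg fun h => hx h.1]
  rw [Finset.sum_congr rfl fun x _ => hterm x, Finset.sum_boole, hset, Set.ncard_coe_finset]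

/-- `Σ_x 𝟙_T(x) = |T|`. [folklore] -/
private theorem sum_indicator_eq_card (T : Finset E) : ∑ x, (if x ∈ T then (1 : ℚ) else 0) = (T.card : ℚ) := by
  classical
  rw [Finset.sum_boole]
  congr 2
  ext x
  simp only [Finset.mem_filter, Finset.mem_univ, true_and]

omit [Fintype E] [DecidableEq E] in
/-- `#{x ∈ T | g x ∈ Ψ} + #{x ∈ T | g x ∉ Ψ} = |T|`. [folklore] -/
private theorem ncard_add_ncard_not (Ψ : Set E) (T : Finset E) (g : G) :
    {x | x ∈ T ∧ g • x ∈ Ψ}.ncard + {x | x ∈ T ∧ g • x ∉ Ψ}.ncard = T.card := by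
  have hdisj : Disjoint {x | x ∈ T ∧ g • x ∈ Ψ} {x | x ∈ T ∧ g • x ∉ Ψ} :=
    Set.disjoint_left.mpr fun x hx hx' => hx'.2 hx.2
  have hunion : {x | x ∈ T ∧ g • x ∈ Ψ} ∪ {x | x ∈ T ∧ g • x ∉ Ψ} = (T : Set E) := by
    ext x
    simp only [Set.mem_union, Set.mem_setOf_eq, Finset.mem_coe]
    tauto
  have hfin₁ : {x | x ∈ T ∧ g • x ∈ Ψ}.Finite := T.finite_toSet.subset fun x hx => hx.1
  have hfin₂ : {x | x ∈ T ∧ g • x ∉ Ψ}.Finite := T.finite_toSet.subset fun x hx => hx.1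
  rw [← Set.ncard_union_eq hdisj hfin₁ hfin₂, hunion, Set.ncard_coe_finset]

/-- **Pohlmann's counting condition `#{x ∈ T | g x ∈ Ψ} = #{x ∈ T | g x ∉ Ψ}` (all `g`) for a finite weight `T` is
balancedness `2 Σ_x 𝟙_T(x)[g x ∈ Ψ] = Σ_x 𝟙_T(x)` of its indicator** (Gordon (9.2.1) `|τΔ ∩ S| = |τΔ ∩ S̄|`).
[cite: Gordon1999HodgeAVSurvey, §9.2 (9.2.1)] -/
theorem isBalanced_indicator_iff_forall_ncard_eq (Ψ : Set E) (T : Finset E) :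
    IsBalanced G Ψ (fun x => if x ∈ T then (1 : ℚ) else 0) ↔
      ∀ g : G, {x | x ∈ T ∧ g • x ∈ Ψ}.ncard = {x | x ∈ T ∧ g • x ∉ Ψ}.ncard := by
  refine forall_congr' fun g => ?_
  rw [sum_indicator_mul_translateInd, sum_indicator_eq_card]
  have htot := ncard_add_ncard_not Ψ T g
  constructor
  · intro h
    have h' : 2 * {x | x ∈ T ∧ g • x ∈ Ψ}.ncard = T.card := by exact_mod_cast h
    omega
  · intro h
    have h' : 2 * {x | x ∈ T ∧ g • x ∈ Ψ}.ncard = T.card := by omega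
    exact_mod_cast h'

omit [Fintype E] [DecidableEq E] in
/-- A weight balanced in the counting sense has even size `|T| = 2 · #{x ∈ T | x ∈ Ψ}` (take `g = 1`).
[cite: Gordon1999HodgeAVSurvey, §9.2 (9.2.1)] -/
theorem card_eq_two_mul_ncard_of_forall_ncard_eq (Ψ : Set E) (T : Finset E)
    (h : ∀ g : G, {x | x ∈ T ∧ g • x ∈ Ψ}.ncard = {x | x ∈ T ∧ g • x ∉ Ψ}.ncard) :
    T.card = 2 * {x | x ∈ T ∧ x ∈ Ψ}.ncard := by
  have h1 := h 1
  have htot := ncard_add_ncard_not Ψ T (1 : G)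
  simp only [one_smul] at h1 htot
  omega

end Indicator

/-! ### §2 The glued weight condition of the engine, and block splitting from rank additivity -/

section Split

variable {n m : ℕ} {K : Fin n → Type} {K' : Fin m → Type}
  [∀ i, Field (K i)] [∀ i, NumberField (K i)] [∀ j, Field (K' j)] [∀ j, NumberField (K' j)]

omit [∀ i, NumberField (K i)] [∀ j, NumberField (K' j)] in
/-- `τ • z` lies in the glued type `Σ ⊔ Σ'` iff `τ ∘ z.2` lies in the type of `z`'s block and slot (the engine's
`Sum.elim` form of the condition). [cite: Deligne1982HodgeCycles, I Ex. 3.7 (c)] -/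
theorem smul_mem_sum_familyType_iff (Φ : ∀ i, CMType (K i)) (Φ' : ∀ j, CMType (K' j)) (τ : ℂ ≃+* ℂ)
    (z : (Σ i, (K i →+* ℂ)) ⊕ (Σ j, (K' j →+* ℂ))) :
    τ • z ∈ {z : (Σ i, (K i →+* ℂ)) ⊕ (Σ j, (K' j →+* ℂ)) |
        Sum.elim (· ∈ CMAlgebra.familyType Φ) (· ∈ CMAlgebra.familyType Φ') z} ↔
      Sum.elim (fun x : (Σ i, (K i →+* ℂ)) => (τ : ℂ →+* ℂ).comp x.2 ∈ (Φ x.1).1)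
        (fun y : (Σ j, (K' j →+* ℂ)) => (τ : ℂ →+* ℂ).comp y.2 ∈ (Φ' y.1).1) z := by
  rcases z with x | y
  · rw [Sum.smul_inl]
    exact CMAlgebra.smul_mem_familyType_iff Φ τ x
  · rw [Sum.smul_inr]
    exact CMAlgebra.smul_mem_familyType_iff Φ' τ y

variable [∀ i, IsCMField (K i)] [∀ j, IsCMField (K' j)]

/-- **Block splitting from rank additivity.**  If `rank(Σ ⊔ Σ') + 1 = cmFamilyRank Φ + cmFamilyRank Φ'` (i.e.
`Hg(X × Y) = Hg(X) × Hg(Y)`), then every weight `S ⊆ (⊔_i Hom(K_i,ℂ)) ⊔ (⊔_j Hom(K'_j,ℂ))` satisfying Pohlmann's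
condition for the glued CM pair with value `p` has balanced blocks `S.toLeft ∈ pohlmannSetsAlg Φ p₁`,
`S.toRight ∈ pohlmannSetsAlg Φ' p₂`, `p₁ + p₂ = p` — the hypothesis of `hodgeClassesProductSpan_biproduct_of_blocksSplit`;
generalises `exists_pohlmannSetsAlg_toLeft_toRight` (blockwise independent action).  Proof: the indicator of `S` is a
balanced weight of `Σ ⊔ Σ'`; by `isBalanced_inl/inr_of_typeRank_sum_eq` its blocks — the indicators of `S.toLeft`,
`S.toRight` — are balanced; `|S| = |S.toLeft| + |S.toRight|` gives `p = p₁ + p₂`. [cite: MoonenZarhin1999LowDim, §3 (3.1)]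
[cite: Gordon1999HodgeAVSurvey, §9.2 (9.2.1)] -/
theorem exists_pohlmannSetsAlg_toLeft_toRight_of_typeRank_add [NeZero n] [NeZero m] (Φ : ∀ i, CMType (K i))
    (Φ' : ∀ j, CMType (K' j))
    (hrank : typeRank (ℂ ≃+* ℂ) {z : (Σ i, (K i →+* ℂ)) ⊕ (Σ j, (K' j →+* ℂ)) |
        Sum.elim (· ∈ CMAlgebra.familyType Φ) (· ∈ CMAlgebra.familyType Φ') z} + 1 =
      CMAlgebra.cmFamilyRank Φ + CMAlgebra.cmFamilyRank Φ')
    (S : Finset ((Σ i, (K i →+* ℂ)) ⊕ (Σ j, (K' j →+* ℂ)))) (p : ℕ)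
    (hS : ∀ τ : ℂ ≃+* ℂ,
      {z | z ∈ S ∧ Sum.elim (fun x : (Σ i, (K i →+* ℂ)) => (τ : ℂ →+* ℂ).comp x.2 ∈ (Φ x.1).1)
        (fun y : (Σ j, (K' j →+* ℂ)) => (τ : ℂ →+* ℂ).comp y.2 ∈ (Φ' y.1).1) z}.ncard = p ∧
      {z | z ∈ S ∧ ¬ Sum.elim (fun x : (Σ i, (K i →+* ℂ)) => (τ : ℂ →+* ℂ).comp x.2 ∈ (Φ x.1).1)
        (fun y : (Σ j, (K' j →+* ℂ)) => (τ : ℂ →+* ℂ).comp y.2 ∈ (Φ' y.1).1) z}.ncard = p) :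
    ∃ p₁ p₂ : ℕ, p₁ + p₂ = p ∧ S.toLeft ∈ pohlmannSetsAlg Φ p₁ ∧ S.toRight ∈ pohlmannSetsAlg Φ' p₂ := by
  classical
  -- notation-free abbreviations
  set T₁ : Set (Σ i, (K i →+* ℂ)) := CMAlgebra.familyType Φ with hT₁
  set T₂ : Set (Σ j, (K' j →+* ℂ)) := CMAlgebra.familyType Φ' with hT₂
  have h₁ : IsCMTypeWith (starRingAut : ℂ ≃+* ℂ) T₁ := CMAlgebra.isCMTypeWith_familyType Φ
  have h₂ : IsCMTypeWith (starRingAut : ℂ ≃+* ℂ) T₂ := CMAlgebra.isCMTypeWith_familyType Φ'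
  haveI : Nonempty (Σ i, (K i →+* ℂ)) := by
    obtain ⟨s⟩ := (inferInstance : Nonempty (K 0 →+* ℂ))
    exact ⟨⟨0, s⟩⟩
  haveI : Nonempty (Σ j, (K' j →+* ℂ)) := by
    obtain ⟨t⟩ := (inferInstance : Nonempty (K' 0 →+* ℂ))
    exact ⟨⟨0, t⟩⟩
  -- the glued condition in `•` form
  have hS'' : ∀ τ : ℂ ≃+* ℂ,
      {z | z ∈ S ∧ τ • z ∈ {z : (Σ i, (K i →+* ℂ)) ⊕ (Σ j, (K' j →+* ℂ)) | Sum.elim (· ∈ T₁) (· ∈ T₂) z}}.ncard = p ∧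
        {z | z ∈ S ∧ τ • z ∉ {z : (Σ i, (K i →+* ℂ)) ⊕ (Σ j, (K' j →+* ℂ)) | Sum.elim (· ∈ T₁) (· ∈ T₂) z}}.ncard = p := by
    intro τ
    obtain ⟨hin, hout⟩ := hS τ
    rw [show {z | z ∈ S ∧ τ • z ∈ {z : (Σ i, (K i →+* ℂ)) ⊕ (Σ j, (K' j →+* ℂ)) | Sum.elim (· ∈ T₁) (· ∈ T₂) z}} =
        {z | z ∈ S ∧ Sum.elim (fun x : (Σ i, (K i →+* ℂ)) => (τ : ℂ →+* ℂ).comp x.2 ∈ (Φ x.1).1)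
          (fun y : (Σ j, (K' j →+* ℂ)) => (τ : ℂ →+* ℂ).comp y.2 ∈ (Φ' y.1).1) z} from
        Set.ext fun z => and_congr_right fun _ => smul_mem_sum_familyType_iff Φ Φ' τ z,
      show {z | z ∈ S ∧ τ • z ∉ {z : (Σ i, (K i →+* ℂ)) ⊕ (Σ j, (K' j →+* ℂ)) | Sum.elim (· ∈ T₁) (· ∈ T₂) z}} =
        {z | z ∈ S ∧ ¬ Sum.elim (fun x : (Σ i, (K i →+* ℂ)) => (τ : ℂ →+* ℂ).comp x.2 ∈ (Φ x.1).1)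
          (fun y : (Σ j, (K' j →+* ℂ)) => (τ : ℂ →+* ℂ).comp y.2 ∈ (Φ' y.1).1) z} from
        Set.ext fun z => and_congr_right fun _ => not_congr (smul_mem_sum_familyType_iff Φ Φ' τ z)]
    exact ⟨hin, hout⟩
  have hS' : ∀ τ : ℂ ≃+* ℂ,
      {z | z ∈ S ∧ τ • z ∈ {z : (Σ i, (K i →+* ℂ)) ⊕ (Σ j, (K' j →+* ℂ)) | Sum.elim (· ∈ T₁) (· ∈ T₂) z}}.ncard =
        {z | z ∈ S ∧ τ • z ∉ {z : (Σ i, (K i →+* ℂ)) ⊕ (Σ j, (K' j →+* ℂ)) | Sum.elim (· ∈ T₁) (· ∈ T₂) z}}.ncard :=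
    fun τ => (hS'' τ).1.trans (hS'' τ).2.symm
  -- the indicator of `S` is balanced for the glued type, hence so are its blocks
  have hbal : IsBalanced (ℂ ≃+* ℂ) {z : (Σ i, (K i →+* ℂ)) ⊕ (Σ j, (K' j →+* ℂ)) | Sum.elim (· ∈ T₁) (· ∈ T₂) z}
      (fun z => if z ∈ S then (1 : ℚ) else 0) :=
    (isBalanced_indicator_iff_forall_ncard_eq _ S).2 hS'
  have hbal₁ := isBalanced_inl_of_typeRank_sum_eq h₁ h₂ hrank hbal
  have hbal₂ := isBalanced_inr_of_typeRank_sum_eq h₁ h₂ hrank hbal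
  have hinl : ((fun z => if z ∈ S then (1 : ℚ) else 0) ∘ Sum.inl) =
      fun x : (Σ i, (K i →+* ℂ)) => if x ∈ S.toLeft then (1 : ℚ) else 0 := by
    funext x
    simp only [Function.comp_apply, Finset.mem_toLeft]
  have hinr : ((fun z => if z ∈ S then (1 : ℚ) else 0) ∘ Sum.inr) =
      fun y : (Σ j, (K' j →+* ℂ)) => if y ∈ S.toRight then (1 : ℚ) else 0 := by
    funext y
    simp only [Function.comp_apply, Finset.mem_toRight]
  rw [hinl] at hbal₁
  rw [hinr] at hbal₂
  have hc₁ := (isBalanced_indicator_iff_forall_ncard_eq T₁ S.toLeft).1 hbal₁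
  have hc₂ := (isBalanced_indicator_iff_forall_ncard_eq T₂ S.toRight).1 hbal₂
  -- the blocks are balanced weights of the two families
  have hG₁ : IsGaloisBalancedAlg Φ S.toLeft := fun τ => by
    have h := hc₁ τ
    simp only [hT₁, CMAlgebra.smul_mem_familyType_iff] at h
    exact h
  have hG₂ : IsGaloisBalancedAlg Φ' S.toRight := fun τ => by
    have h := hc₂ τ
    simp only [hT₂, CMAlgebra.smul_mem_familyType_iff] at h
    exact h
  -- sizes: `|S.toLeft| = 2 p₁`, `|S.toRight| = 2 p₂`, `|S| = 2 p`
  have hcard₁ := card_eq_two_mul_ncard_of_forall_ncard_eq T₁ S.toLeft hc₁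
  have hcard₂ := card_eq_two_mul_ncard_of_forall_ncard_eq T₂ S.toRight hc₂
  have hcard : S.card = 2 * p := by
    have htot := ncard_add_ncard_not
      {z : (Σ i, (K i →+* ℂ)) ⊕ (Σ j, (K' j →+* ℂ)) | Sum.elim (· ∈ T₁) (· ∈ T₂) z} S (1 : ℂ ≃+* ℂ)
    obtain ⟨hin, hout⟩ := hS'' 1
    omega
  refine ⟨{x | x ∈ S.toLeft ∧ x ∈ T₁}.ncard, {y | y ∈ S.toRight ∧ y ∈ T₂}.ncard, ?_, ⟨hcard₁, hG₁⟩, ⟨hcard₂, hG₂⟩⟩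
  have hsum := Finset.card_toLeft_add_card_toRight (u := S)
  omega

/-- **The always-true inequality `rank(Σ ⊔ Σ') + 1 ≤ cmFamilyRank Φ + cmFamilyRank Φ'`** (`dim MT(X × Y) + 1 ≤
dim MT(X) + dim MT(Y)`, i.e. `Hg(X × Y) ⊆ Hg(X) × Hg(Y)`); rank additivity is the extreme case.
[cite: Gordon1999HodgeAVSurvey, 7.7] -/
theorem typeRank_sum_add_one_le_cmFamilyRank [NeZero n] [NeZero m] (Φ : ∀ i, CMType (K i)) (Φ' : ∀ j, CMType (K' j)) :
    typeRank (ℂ ≃+* ℂ) {z : (Σ i, (K i →+* ℂ)) ⊕ (Σ j, (K' j →+* ℂ)) |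
        Sum.elim (· ∈ CMAlgebra.familyType Φ) (· ∈ CMAlgebra.familyType Φ') z} + 1 ≤
      CMAlgebra.cmFamilyRank Φ + CMAlgebra.cmFamilyRank Φ' := by
  haveI : Nonempty (Σ i, (K i →+* ℂ)) := by
    obtain ⟨s⟩ := (inferInstance : Nonempty (K 0 →+* ℂ))
    exact ⟨⟨0, s⟩⟩
  haveI : Nonempty (Σ j, (K' j →+* ℂ)) := by
    obtain ⟨t⟩ := (inferInstance : Nonempty (K' 0 →+* ℂ))
    exact ⟨⟨0, t⟩⟩
  exact typeRank_sum_add_one_le (CMAlgebra.isCMTypeWith_familyType Φ) (CMAlgebra.isCMTypeWith_familyType Φ')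

/-- **Blockwise independence is a special case of rank additivity**: if every `τ ∈ Aut(ℂ)` agrees on all `Hom(K_i, ℂ)`
with some `τ₁` fixing all `Hom(K'_j, ℂ)` (the hypothesis of `hodgeClassesProductSpan_biproduct_of_blockwiseIndependent`),
then `rank(Σ ⊔ Σ') + 1 = cmFamilyRank Φ + cmFamilyRank Φ'`. [cite: Gordon1999HodgeAVSurvey, §3 Theorem (Imai, Murty), proof] -/
theorem typeRank_sum_add_one_eq_of_blockwiseIndependent [NeZero n] [NeZero m] (Φ : ∀ i, CMType (K i))
    (Φ' : ∀ j, CMType (K' j))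
    (hind : ∀ τ : ℂ ≃+* ℂ, ∃ τ₁ : ℂ ≃+* ℂ,
      (∀ (i : Fin n) (s : K i →+* ℂ), (τ₁ : ℂ →+* ℂ).comp s = (τ : ℂ →+* ℂ).comp s) ∧
      ∀ (j : Fin m) (t : K' j →+* ℂ), (τ₁ : ℂ →+* ℂ).comp t = t) :
    typeRank (ℂ ≃+* ℂ) {z : (Σ i, (K i →+* ℂ)) ⊕ (Σ j, (K' j →+* ℂ)) |
        Sum.elim (· ∈ CMAlgebra.familyType Φ) (· ∈ CMAlgebra.familyType Φ') z} + 1 =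
      CMAlgebra.cmFamilyRank Φ + CMAlgebra.cmFamilyRank Φ' := by
  haveI : Nonempty (Σ i, (K i →+* ℂ)) := by
    obtain ⟨s⟩ := (inferInstance : Nonempty (K 0 →+* ℂ))
    exact ⟨⟨0, s⟩⟩
  haveI : Nonempty (Σ j, (K' j →+* ℂ)) := by
    obtain ⟨t⟩ := (inferInstance : Nonempty (K' 0 →+* ℂ))
    exact ⟨⟨0, t⟩⟩
  refine typeRank_sum_add_one_eq_of_blockwise (CMAlgebra.isCMTypeWith_familyType Φ)
    (CMAlgebra.isCMTypeWith_familyType Φ') fun τ => ?_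
  obtain ⟨τ₁, h1, h2⟩ := hind τ
  refine ⟨τ₁, fun x => ?_, fun y => ?_⟩
  · obtain ⟨i, s⟩ := x
    rw [CMAlgebra.smul_sigma_mk, CMAlgebra.smul_sigma_mk, ringEquiv_smul_def, ringEquiv_smul_def]
    exact congrArg (Sigma.mk i) (h1 i s)
  · obtain ⟨j, t⟩ := y
    rw [CMAlgebra.smul_sigma_mk, ringEquiv_smul_def]
    exact congrArg (Sigma.mk j) (h2 j t)

end Split

/-! ### §3 The product-span theorem under rank additivity, and consequences -/

section Main

variable {n m : ℕ} {K : Fin n → Type} {K' : Fin m → Type}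
  [∀ i, Field (K i)] [∀ i, NumberField (K i)] [∀ j, Field (K' j)] [∀ j, NumberField (K' j)]
  [∀ i, IsCMField (K i)] [∀ j, IsCMField (K' j)]
  {Φ : ∀ i, CMType (K i)} {Φ' : ∀ j, CMType (K' j)}
  {A : Fin n → AbelianVariety ℂ} {A' : Fin m → AbelianVariety ℂ}
  {ι : ∀ i, 𝓞 (K i) →+* End (A i)} {ι' : ∀ j, 𝓞 (K' j) →+* End (A' j)}
  {θ : ∀ i, K i →+* Module.End ℂ (complexBetti (A i).X 1)}
  {θ' : ∀ j, K' j →+* Module.End ℂ (complexBetti (A' j).X 1)}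

/-- **Moonen–Zarhin (3.1) for CM abelian varieties: rank additivity ⟹ Hodge classes on `X × Y` are spanned by
exterior products of Hodge classes of `X` and of `Y`.**  For realisations `(A_i, ι_i, θ_i)` of CM types `Φ_i` of CM
fields `K_i` (`i < n`, `n ≠ 0`) and `(A'_j, ι'_j, θ'_j)` of `Φ'_j` of `K'_j` (`j < m`, `m ≠ 0`): if the rank of the
glued type `Σ ⊔ Σ'` of `∏ K_i × ∏ K'_j` satisfies `rank(Σ ⊔ Σ') + 1 = cmFamilyRank Φ + cmFamilyRank Φ'` — equivalently
`dim MT(X × Y) + 1 = dim MT(X) + dim MT(Y)`, `Hg(X × Y) = Hg(X) × Hg(Y)` — then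
`HodgeTheory.HodgeClassesProductSpan (⨁ A) (⨁ A')`. [cite: MoonenZarhin1999LowDim, §3 (3.1)]
[cite: Gordon1999HodgeAVSurvey, §3 Theorem (Imai, Murty) with proof] [cite: GaoUllmo2025, Thm. 3.1 with proof] -/
theorem hodgeClassesProductSpan_biproduct_of_typeRank_add [NeZero n] [NeZero m]
    (hA : ∀ i, IsCMTypeRealisation (Φ i) (A i) (ι i) (θ i))
    (hA' : ∀ j, IsCMTypeRealisation (Φ' j) (A' j) (ι' j) (θ' j))
    (hrank : typeRank (ℂ ≃+* ℂ) {z : (Σ i, (K i →+* ℂ)) ⊕ (Σ j, (K' j →+* ℂ)) |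
        Sum.elim (· ∈ CMAlgebra.familyType Φ) (· ∈ CMAlgebra.familyType Φ') z} + 1 =
      CMAlgebra.cmFamilyRank Φ + CMAlgebra.cmFamilyRank Φ') :
    HodgeClassesProductSpan (⨁ A) (⨁ A') :=
  hodgeClassesProductSpan_biproduct_of_blocksSplit hA hA' fun S p hS =>
    exists_pohlmannSetsAlg_toLeft_toRight_of_typeRank_add Φ Φ' hrank S p hS

/-- **Isogenous factors**: for `X ~ ⨁ A_i`, `Y ~ ⨁ A'_j` with rank-additive types, `HodgeClassesProductSpan X Y`
(isogeny invariance of the predicate). [cite: MoonenZarhin1999LowDim, §3 (3.1)] [cite: vanGeemen1994HodgeAV, §3.6 (p. 236)] -/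
theorem hodgeClassesProductSpan_of_isIsogenous_biproduct_of_typeRank_add [NeZero n] [NeZero m]
    (hA : ∀ i, IsCMTypeRealisation (Φ i) (A i) (ι i) (θ i))
    (hA' : ∀ j, IsCMTypeRealisation (Φ' j) (A' j) (ι' j) (θ' j))
    (hrank : typeRank (ℂ ≃+* ℂ) {z : (Σ i, (K i →+* ℂ)) ⊕ (Σ j, (K' j →+* ℂ)) |
        Sum.elim (· ∈ CMAlgebra.familyType Φ) (· ∈ CMAlgebra.familyType Φ') z} + 1 =
      CMAlgebra.cmFamilyRank Φ + CMAlgebra.cmFamilyRank Φ')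
    {X Y : AbelianVariety ℂ} (hXi : AbelianVariety.IsIsogenous X (⨁ A))
    (hYi : AbelianVariety.IsIsogenous Y (⨁ A')) : HodgeClassesProductSpan X Y :=
  (hodgeClassesProductSpan_biproduct_of_typeRank_add hA hA' hrank).of_isIsogenous hXi hYi

/-- **HC(`X`) ∧ HC(`Y`) ⟹ HC(`X × Y`)** for `X ~ ⨁ A_i`, `Y ~ ⨁ A'_j` CM products with rank-additive types
(`Hg(X × Y) = Hg(X) × Hg(Y)`): exterior products of algebraic classes are algebraic
(`hodgeConjectureFor_prod_of_productSpan`). [cite: MoonenZarhin1999LowDim, §3 (3.1)]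
[cite: vanGeemen1994HodgeAV, §3.5–3.7 Lemma 3.7 (p. 236)] -/
theorem hodgeConjectureFor_prod_of_isIsogenous_biproduct_of_typeRank_add [NeZero n] [NeZero m]
    (hA : ∀ i, IsCMTypeRealisation (Φ i) (A i) (ι i) (θ i))
    (hA' : ∀ j, IsCMTypeRealisation (Φ' j) (A' j) (ι' j) (θ' j))
    (hrank : typeRank (ℂ ≃+* ℂ) {z : (Σ i, (K i →+* ℂ)) ⊕ (Σ j, (K' j →+* ℂ)) |
        Sum.elim (· ∈ CMAlgebra.familyType Φ) (· ∈ CMAlgebra.familyType Φ') z} + 1 =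
      CMAlgebra.cmFamilyRank Φ + CMAlgebra.cmFamilyRank Φ')
    {X Y : AbelianVariety ℂ} (hXi : AbelianVariety.IsIsogenous X (⨁ A))
    (hYi : AbelianVariety.IsIsogenous Y (⨁ A')) (hHX : HodgeConjectureFor X.dim X.X)
    (hHY : HodgeConjectureFor Y.dim Y.X) : HodgeConjectureFor (X.prod Y).dim (X.prod Y).X :=
  hodgeConjectureFor_prod_of_productSpan X Y
    (hodgeClassesProductSpan_of_isIsogenous_biproduct_of_typeRank_add hA hA' hrank hXi hYi) hHX hHY

end Main

end Literature.AlgebraicGeometry.Pohlmann1968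

end
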